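import Literature.Computability.Complexity.HalvingMath
import HarnessLib

/-!
# One level of exact halving with concrete prime blocks (arithmetic glue)

Pure arithmetic (theorems only): the level formula of `HalvingMath.div_two_pow_mod_three_eq`
instantiated with the concrete auxiliary set `AUX = P(N; 2, 2 + L s)` of primes `q < N` with index
in `[2, 2 + L s)`, its blocks `P(N; 2 + L i, 2 + L (i+1))` of `L` primes each (all `≥ 5`, so each
block product is `≥ 4ᴸ`), and the Fermat inverses `h_q = ((B/q) mod q)^{q-2} mod q`
(`level_div_two_pow_mod_three_eq`); together with the identification of the quantities the `CH`
circuits compute — the rank as a window of the approximation sum over a range with coefficients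
supported on `AUX` (`rank_eq_approx_window`), the reconstruction sum modulo `3`
(`crrSum_mod_three_eq`) — this is the arithmetic half of "division by `2ˢ` is in `CH`"
(Hesse–Allender–Barrington 2002, Thm. 4.1, via Bürgisser 2009, Thm. 3.4, scaled up).

## References

* W. Hesse, E. Allender, D. A. M. Barrington, JCSS 65 (2002), §4, Thm. 4.1.
* P. Bürgisser, ECCC TR06-113 (2006), Thm. 3.4.
-/

namespace Literature.Computability.Complexity

open Finset Nat

/-- A prime of a set of distinct primes does not divide the product of the others. [folklore] -/
theorem prod_erase_mod_ne_zero (S : Finset ℕ) (hS : ∀ p ∈ S, p.Prime) {q : ℕ} (hq : q ∈ S) :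
    (∏ r ∈ S.erase q, r) % q ≠ 0 := by
  intro h
  have hdvd : q ∣ ∏ r ∈ S.erase q, r := Nat.dvd_of_mod_eq_zero h
  rcases (Prime.dvd_finsetProd_iff (hS q hq).prime _).1 hdvd with ⟨r, hr, hqr⟩
  have hr' := Finset.mem_erase.1 hr
  have := (Nat.prime_dvd_prime_iff_eq (hS q hq) (hS r hr'.2)).1 hqr
  exact hr'.1 this.symm

/-- **Fermat inverses of the cofactors**: `h_q = ((B/q) mod q)^{q-2} mod q` satisfies
`h_q · (B/q) ≡ 1 (mod q)`. [folklore] -/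
theorem fermatInv_mul_prod_erase_mod (S : Finset ℕ) (hS : ∀ p ∈ S, p.Prime) {q : ℕ} (hq : q ∈ S) :
    ((∏ r ∈ S.erase q, r) % q) ^ (q - 2) % q * (∏ r ∈ S.erase q, r) % q = 1 := by
  rw [Nat.mul_mod, Nat.mod_mod, ← Nat.mul_mod]
  exact mod_pow_sub_two_mul_mod (hS q hq) (prod_erase_mod_ne_zero S hS hq)

section Level

variable (N L s : ℕ)

/-- **The level formula with concrete blocks** (HAB 2002, Thm. 4.1, exact form): with
`AUX = P(N; 2, 2 + L s)`, blocks `fᵢ = ∏ P(N; 2 + L i, 2 + L(i+1))`, `K = ∏ (fᵢ+1)/2`, `Y = XK`,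
`B = ∏ AUX`, Fermat inverses `h_q`, `C = ∑_q (Y mod q) h_q (B/q)`, `rk = C/B`, and provided the
primes exist below `N` (`2 + L s ≤ #{primes < N}`), `2s ≤ 4ᴸ` and `2sX < 4ᴸ`:
`⌊X/2ˢ⌋ mod 3 = ((Y mod 3 + 3 - ((C mod 3 + 3 - ((B mod 3)·rk) mod 3) mod 3))·(B mod 3)) mod 3`. [cite: HesseAllenderBarrington2002, Theorem 4.1] -/
theorem level_div_two_pow_mod_three_eq (X : ℕ) (hsup : 2 + L * s ≤ Nat.count Nat.Prime N)
    (hs : 2 * s ≤ 2 ^ (2 * L)) (hX : 2 * s * X < 2 ^ (2 * L)) (h : ℕ → ℕ)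
    (hh : ∀ q ∈ (range N).filter (fun q => q.Prime ∧ 2 ≤ Nat.count Nat.Prime q ∧ Nat.count Nat.Prime q < 2 + L * s),
      h q = ((∏ r ∈ ((range N).filter (fun q => q.Prime ∧ 2 ≤ Nat.count Nat.Prime q ∧ Nat.count Nat.Prime q < 2 + L * s)).erase q, r)
        % q) ^ (q - 2) % q) :
    X / 2 ^ s % 3 =
      (((X * ∏ i ∈ range s, ((∏ q ∈ (range N).filter (fun q => q.Prime ∧ 2 + L * i ≤ Nat.count Nat.Prime q ∧
            Nat.count Nat.Prime q < 2 + L * (i + 1)), q) + 1) / 2) % 3 + 3 -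
          ((∑ q ∈ (range N).filter (fun q => q.Prime ∧ 2 ≤ Nat.count Nat.Prime q ∧ Nat.count Nat.Prime q < 2 + L * s),
              (X * ∏ i ∈ range s, ((∏ q ∈ (range N).filter (fun q => q.Prime ∧ 2 + L * i ≤ Nat.count Nat.Prime q ∧
                Nat.count Nat.Prime q < 2 + L * (i + 1)), q) + 1) / 2) % q * h q *
              ∏ r ∈ ((range N).filter (fun q => q.Prime ∧ 2 ≤ Nat.count Nat.Prime q ∧ Nat.count Nat.Prime q < 2 + L * s)).erase q, r)
              % 3 + 3 -
            (∏ q ∈ (range N).filter (fun q => q.Prime ∧ 2 ≤ Nat.count Nat.Prime q ∧ Nat.count Nat.Prime q < 2 + L * s), q) % 3 *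
              ((∑ q ∈ (range N).filter (fun q => q.Prime ∧ 2 ≤ Nat.count Nat.Prime q ∧ Nat.count Nat.Prime q < 2 + L * s),
                (X * ∏ i ∈ range s, ((∏ q ∈ (range N).filter (fun q => q.Prime ∧ 2 + L * i ≤ Nat.count Nat.Prime q ∧
                  Nat.count Nat.Prime q < 2 + L * (i + 1)), q) + 1) / 2) % q * h q *
                ∏ r ∈ ((range N).filter (fun q => q.Prime ∧ 2 ≤ Nat.count Nat.Prime q ∧ Nat.count Nat.Prime q < 2 + L * s)).erase q, r) /
              ∏ q ∈ (range N).filter (fun q => q.Prime ∧ 2 ≤ Nat.count Nat.Prime q ∧ Nat.count Nat.Prime q < 2 + L * s), q) % 3) % 3) *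
        ((∏ q ∈ (range N).filter (fun q => q.Prime ∧ 2 ≤ Nat.count Nat.Prime q ∧ Nat.count Nat.Prime q < 2 + L * s), q) % 3)) % 3 := by
  have hprime : ∀ q ∈ (range N).filter (fun q => q.Prime ∧ 2 ≤ Nat.count Nat.Prime q ∧ Nat.count Nat.Prime q < 2 + L * s), q.Prime :=
    fun q hq => (mem_primeIdxSet.1 hq).2.1
  -- the hypotheses of `div_two_pow_mod_three_eq`, stated with the block function applied (β-redex form,
  -- which keeps the final instantiation syntactic)
  have h1 : (∏ q ∈ (range N).filter (fun q => q.Prime ∧ 2 ≤ Nat.count Nat.Prime q ∧ Nat.count Nat.Prime q < 2 + L * s), q) % 3 ≠ 0 :=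
    prod_primeIdxSet_mod_three_ne_zero le_rfl
  have h2 : ∏ i ∈ range s, (fun i => ∏ q ∈ (range N).filter (fun q => q.Prime ∧ 2 + L * i ≤ Nat.count Nat.Prime q ∧
      Nat.count Nat.Prime q < 2 + L * (i + 1)), q) i =
      ∏ q ∈ (range N).filter (fun q => q.Prime ∧ 2 ≤ Nat.count Nat.Prime q ∧ Nat.count Nat.Prime q < 2 + L * s), q := by
    simpa only using prod_blocks_eq N 2 L s
  have h3 : ∀ i < s, (fun i => ∏ q ∈ (range N).filter (fun q => q.Prime ∧ 2 + L * i ≤ Nat.count Nat.Prime q ∧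
      Nat.count Nat.Prime q < 2 + L * (i + 1)), q) i % 2 = 1 := fun i _ => by
    simpa only using (prod_primeIdxSet_mod_two (N := N) (a := 2 + L * i) (b := 2 + L * (i + 1)) (Nat.le_add_right 2 _))
  have hf : ∀ i < s, 2 ^ (2 * L) ≤ (fun i => ∏ q ∈ (range N).filter (fun q => q.Prime ∧ 2 + L * i ≤ Nat.count Nat.Prime q ∧
      Nat.count Nat.Prime q < 2 + L * (i + 1)), q) i := by
    intro i hi
    have hN : 2 + L * (i + 1) ≤ Nat.count Nat.Prime N := le_trans (by nlinarith) hsup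
    have key : 2 ^ (2 * L) ≤ ∏ q ∈ (range N).filter (fun q => q.Prime ∧ 2 + L * i ≤ Nat.count Nat.Prime q ∧
        Nat.count Nat.Prime q < 2 + L * (i + 1)), q :=
      calc 2 ^ (2 * L) = 4 ^ (2 + L * (i + 1) - (2 + L * i)) := by
            rw [show 2 + L * (i + 1) - (2 + L * i) = L by rw [Nat.mul_succ]; omega, pow_mul]; norm_num
        _ ≤ 5 ^ (2 + L * (i + 1) - (2 + L * i)) := Nat.pow_le_pow_left (by norm_num) _
        _ ≤ _ := pow_le_prod_primeIdxSet hN (Nat.le_add_right 2 _)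
    simpa only using key
  have h4 : ∀ q ∈ (range N).filter (fun q => q.Prime ∧ 2 ≤ Nat.count Nat.Prime q ∧ Nat.count Nat.Prime q < 2 + L * s),
      h q * (∏ r ∈ ((range N).filter (fun q => q.Prime ∧ 2 ≤ Nat.count Nat.Prime q ∧ Nat.count Nat.Prime q < 2 + L * s)).erase q, r) % q = 1 :=
    fun q hq => by rw [hh q hq]; exact fermatInv_mul_prod_erase_mod _ hprime hq
  -- (applied in two steps: the partial application keeps the block function un-β-reduced in the
  -- remaining binder types, so that the redex-form hypotheses above match syntactically)
  have key₀ := div_two_pow_mod_three_eq X s (2 ^ (2 * L))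
    ((range N).filter (fun q => q.Prime ∧ 2 ≤ Nat.count Nat.Prime q ∧ Nat.count Nat.Prime q < 2 + L * s))
    (fun i => ∏ q ∈ (range N).filter (fun q => q.Prime ∧ 2 + L * i ≤ Nat.count Nat.Prime q ∧
      Nat.count Nat.Prime q < 2 + L * (i + 1)), q) h hprime h1
  have key := key₀ h2 h3 hf hs hX h4
  simpa only using key

/-- **The rank as a window of the approximation sum** over a range `q < N'`, `N ≤ N'`, with
coefficients `(Y mod q) · h_q` on `AUX` and `0` elsewhere: when `|AUX| N² B < 2ᵀ` and
`|AUX| · N < 2ᵂ`, `(∑_{q<N'} c_q ⌊2ᵀ/q⌋) / 2ᵀ mod 2ᵂ = C / B`. [cite: HesseAllenderBarrington2002, Lemma 4.3] -/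
theorem rank_eq_approx_window (Y N' T W : ℕ) (S : Finset ℕ) (hSN : S ⊆ range N) (hNN : N ≤ N') (hS : ∀ q ∈ S, q.Prime)
    (c h : ℕ → ℕ) (hc : ∀ q, c q = if q ∈ S then Y % q * h q else 0)
    (hh : ∀ q ∈ S, h q * (∏ r ∈ S.erase q, r) % q = 1) (hhlt : ∀ q ∈ S, h q < q)
    (hT : S.card * (N * N) * (∏ q ∈ S, q) < 2 ^ T) (hW : S.card * N < 2 ^ W) :
    (∑ q ∈ range N', c q * (2 ^ T / q)) / 2 ^ T % 2 ^ W =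
      (∑ q ∈ S, Y % q * h q * ∏ r ∈ S.erase q, r) / ∏ q ∈ S, q := by
  have hsupp : ∑ q ∈ range N', c q * (2 ^ T / q) = ∑ q ∈ S, Y % q * h q * (2 ^ T / q) := by
    rw [sum_range_eq_sum_of_support N' S c _ (hSN.trans (Finset.range_subset_range.2 hNN)) (fun q hq => by rw [hc, if_neg hq])]
    exact Finset.sum_congr rfl fun q hq => by rw [hc, if_pos hq]
  have hQ : ∀ q ∈ S, q ≤ N := fun q hq => (Finset.mem_range.1 (hSN hq)).le
  rw [hsupp, crrSum_div_eq_approx_div S hS Y T N h hh hhlt hQ hT]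
  refine Nat.mod_eq_of_lt (lt_of_le_of_lt ?_ hW)
  exact crrSum_div_le S (fun q => Y % q) h N (fun q hq => (hS q hq).pos) (fun q hq => Nat.mod_lt _ (hS q hq).pos) hhlt hQ

/-- **The reconstruction sum modulo `3`** from the supported coefficients and the cofactors
modulo `3`: `(∑_{q<N'} c_q · ((B/q) mod 3)) mod 3 = C mod 3`. [folklore] -/
theorem crrSum_mod_three_eq (Y N' : ℕ) (S : Finset ℕ) (hSN' : S ⊆ range N') (c h : ℕ → ℕ)
    (hc : ∀ q, c q = if q ∈ S then Y % q * h q else 0) :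
    (∑ q ∈ range N', c q * ((∏ r ∈ S.erase q, r) % 3)) % 3 = (∑ q ∈ S, Y % q * h q * ∏ r ∈ S.erase q, r) % 3 := by
  rw [sum_range_eq_sum_of_support N' S c _ hSN' (fun q hq => by rw [hc, if_neg hq])]
  conv_rhs => rw [sum_mul_mod_eq S (fun q => Y % q * h q) (fun q => ∏ r ∈ S.erase q, r) 3]
  congr 1
  exact Finset.sum_congr rfl fun q hq => by rw [hc, if_pos hq]

/-- The Fermat inverse is below `q` (for `q ≥ 1`). [folklore] -/
theorem fermatInv_lt {a q : ℕ} (hq : 0 < q) : (a % q) ^ (q - 2) % q < q := Nat.mod_lt _ hq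

/-- Cardinality of the auxiliary set. [folklore] -/
theorem card_aux_eq (hsup : 2 + L * s ≤ Nat.count Nat.Prime N) :
    ((range N).filter (fun q => q.Prime ∧ 2 ≤ Nat.count Nat.Prime q ∧ Nat.count Nat.Prime q < 2 + L * s)).card = L * s := by
  rw [card_primeIdxSet hsup]; omega

/-- The auxiliary product is at most `N^{L s}`. [folklore] -/
theorem prod_aux_le (hsup : 2 + L * s ≤ Nat.count Nat.Prime N) :
    (∏ q ∈ (range N).filter (fun q => q.Prime ∧ 2 ≤ Nat.count Nat.Prime q ∧ Nat.count Nat.Prime q < 2 + L * s), q) ≤ N ^ (L * s) := by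
  have h := Finset.prod_le_pow_card ((range N).filter (fun q => q.Prime ∧ 2 ≤ Nat.count Nat.Prime q ∧ Nat.count Nat.Prime q < 2 + L * s))
    (fun q => q) N fun q hq => (Finset.mem_range.1 (Finset.mem_filter.1 hq).1).le
  rwa [card_aux_eq N L s hsup] at h

end Level

end Literature.Computability.Complexity
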